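import Summits.RiemannHypothesis.RiemannHypothesis.Theorems.JensenLogBandArcSector
import Summits.RiemannHypothesis.RiemannHypothesis.Theorems.JensenLogBandArcTransform
import HarnessLib

/-!
# The radial bridge between two right half-arc transforms — frame (BAND line, step S5-2c)

RH ladder column JENSEN, rung J-P(P3) «log band», BAND crux `XiDerivBandRealAllRates` of route
«JensenLogBand», line «band-one-window» (u-arc, top-shell reshape), lead rh-jensen-prover g8.
RH-FREE generic complex analysis. WHAT THIS IS NOT: nothing here bears on zeros of `ζ` or the truth
of RH.

The right half-arc transform `U_{n,h}(c) = (n!/2πi)∫_{−π/2}^{π/2} ξ₁(u²)K_{n,c}(u)du` is DEFINED at the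
band radius `h = h(n,T)` but ANALYSED on the circle through the saddle (radius `r = ‖u* − c‖`,
`|h − r| = O(1/ℓ_T)`, eng-2 g6 F4 `norm_arcSaddle_sub_center_sub_radius_le`). By the annular-sector
Cauchy theorem (`LogBandArc.rightArc_sub_rightArc_eq`, S2, p482286) the two transforms differ by the
integrals of `f(u) = ξ₁(u²)K_{n,c}(u)` over the two short vertical segments `c ± iy`, `y` between the
radii:

* `xiSqArcU_sub_xiSqArcU_eq`: `U_{n,a}(c) − U_{n,b}(c) = (n!/2π)·∫_b^a (f(c+iy) + f(c−iy)) dy`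
  (`0 < b ≤ a < 2·Im c`);
* `norm_xiSqArcU_sub_xiSqArcU_le`: a pointwise bound `‖f(c+iy)‖ + ‖f(c−iy)‖ ≤ B` on the segment gives
  `‖U_{n,a}(c) − U_{n,b}(c)‖ ≤ (n!/2π)·(a − b)·B` — the pointwise bound in regime R2 is eng-2 g6's
  [S5b-pt] (F2 at abscissa `½ + x ∈ [0,1]`, vertical `γ̃`, F7c, kernel ratio), of size
  `O(log T)·e^{−(σ*−1−δ)ℓ/2}·‖I(φ₀)‖/r`.
-/

noncomputable section

-- single-problem summit: `Summit.RiemannHypothesis.RiemannHypothesis.…` is the tree convention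
set_option linter.dupNamespace false

open Complex Real Set MeasureTheory intervalIntegral Metric

namespace Summit.RiemannHypothesis.RiemannHypothesis.Theorems.JensenPolynomials.LogBandArc

open Literature.NumberTheory.LFunctions

/-- `f(u) = ξ₁(u²)K_{n,c}(u)` is differentiable at every `u ≠ ±c`. [folklore] -/
theorem differentiableAt_xiSq_sq_mul_sqKernel (n : ℕ) (c : ℂ) {u : ℂ} (huc : u ≠ c) (hupc : u + c ≠ 0) :
    DifferentiableAt ℂ (fun u : ℂ => xiSq (u ^ 2) * sqKernel n c u) u := by
  have hD : u ^ 2 - c ^ 2 ≠ 0 := by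
    have : u ^ 2 - c ^ 2 = (u - c) * (u + c) := by ring
    rw [this]; exact mul_ne_zero (sub_ne_zero.2 huc) hupc
  have h1 : DifferentiableAt ℂ (fun u : ℂ => xiSq (u ^ 2)) u :=
    (differentiable_xiSq _).comp u (differentiableAt_pow 2)
  have h2 : DifferentiableAt ℂ (fun u : ℂ => sqKernel n c u) u := by
    unfold sqKernel
    refine DifferentiableAt.mul (by fun_prop) ?_
    exact DifferentiableAt.inv (by fun_prop) (pow_ne_zero _ hD)
  exact h1.mul h2

/-- **The radial bridge identity**: for `0 < b ≤ a < 2·Im c`,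
`U_{n,a}(c) − U_{n,b}(c) = (n!/2π)·∫_b^a (f(c+iy) + f(c−iy)) dy`, `f(u) = ξ₁(u²)K_{n,c}(u)`. [folklore] -/
theorem xiSqArcU_sub_xiSqArcU_eq (n : ℕ) {c : ℂ} {a b : ℝ} (hb : 0 < b) (hle : b ≤ a)
    (hc : a < 2 * c.im) :
    xiSqArcU n a c - xiSqArcU n b c =
      (n.factorial : ℂ) / (2 * π) *
        ∫ y in b..a, ((fun u : ℂ => xiSq (u ^ 2) * sqKernel n c u) (c + (y : ℂ) * I) +
          (fun u : ℂ => xiSq (u ^ 2) * sqKernel n c u) (c - (y : ℂ) * I)) := by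
  set f : ℂ → ℂ := fun u : ℂ => xiSq (u ^ 2) * sqKernel n c u with hf
  -- differentiability of `f` on the closed right half-annulus
  have hdiff : ∀ u : ℂ, b ≤ ‖u - c‖ → ‖u - c‖ ≤ a → 0 ≤ (u - c).re → DifferentiableAt ℂ f u := by
    intro u h1 h2 _
    have huc : u ≠ c := by
      intro h0; rw [h0, sub_self, norm_zero] at h1; linarith
    have hupc : u + c ≠ 0 := by
      intro h0
      have him : (u + c).im = (u - c).im + 2 * c.im := by simp; ring
      have h3 : |(u - c).im| ≤ ‖u - c‖ := Complex.abs_im_le_norm _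
      have h4 := (abs_le.1 h3).1
      have : (u + c).im = 0 := by rw [h0]; simp
      linarith
    exact differentiableAt_xiSq_sq_mul_sqKernel n c huc hupc
  have hsector := rightArc_sub_rightArc_eq (f := f) hb hle hdiff
  have hI : (2 * (π : ℂ) * I) ≠ 0 := by simp [Real.pi_ne_zero, I_ne_zero]
  have hA : ∀ ρ : ℝ, xiSqArcU n ρ c = (n.factorial : ℂ) / (2 * π * I) *
      ∫ θ in (-(π / 2))..(π / 2), deriv (circleMap c ρ) θ * f (circleMap c ρ θ) := fun ρ => rfl
  rw [hA a, hA b, ← mul_sub, hsector]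
  field_simp

/-- **The radial bridge estimate**: a pointwise bound `‖f(c+iy)‖ + ‖f(c−iy)‖ ≤ B` on `y ∈ [b, a]`
gives `‖U_{n,a}(c) − U_{n,b}(c)‖ ≤ (n!/2π)·(a − b)·B`. [folklore] -/
theorem norm_xiSqArcU_sub_xiSqArcU_le (n : ℕ) {c : ℂ} {a b B : ℝ} (hb : 0 < b) (hle : b ≤ a)
    (hc : a < 2 * c.im)
    (hB : ∀ y ∈ Icc b a, ‖xiSq ((c + (y : ℂ) * I) ^ 2) * sqKernel n c (c + (y : ℂ) * I)‖ +
      ‖xiSq ((c - (y : ℂ) * I) ^ 2) * sqKernel n c (c - (y : ℂ) * I)‖ ≤ B) :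
    ‖xiSqArcU n a c - xiSqArcU n b c‖ ≤ (n.factorial : ℝ) / (2 * π) * ((a - b) * B) := by
  rw [xiSqArcU_sub_xiSqArcU_eq n hb hle hc, norm_mul]
  have hnf : ‖(n.factorial : ℂ) / (2 * π)‖ = (n.factorial : ℝ) / (2 * π) := by
    rw [norm_div, Complex.norm_natCast, norm_mul, Complex.norm_ofNat, Complex.norm_real,
      Real.norm_eq_abs, abs_of_pos Real.pi_pos]
  rw [hnf]
  refine mul_le_mul_of_nonneg_left ?_ (by positivity)
  have hint := intervalIntegral.norm_integral_le_of_norm_le_const (a := b) (b := a) (C := B)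
    (f := fun y : ℝ => xiSq ((c + (y : ℂ) * I) ^ 2) * sqKernel n c (c + (y : ℂ) * I) +
      xiSq ((c - (y : ℂ) * I) ^ 2) * sqKernel n c (c - (y : ℂ) * I)) ?_
  · rw [abs_of_nonneg (by linarith)] at hint
    simpa [mul_comm] using hint
  · intro y hy
    rw [uIoc_of_le hle] at hy
    exact (norm_add_le _ _).trans (hB y ⟨hy.1.le, hy.2⟩)

/-- The symmetric form: radii `a, b ∈ (0, 2·Im c)` in either order, bound on `uIcc a b`. [folklore] -/
theorem norm_xiSqArcU_sub_xiSqArcU_le' (n : ℕ) {c : ℂ} {a b B : ℝ} (ha : 0 < a) (hb : 0 < b)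
    (hac : a < 2 * c.im) (hbc : b < 2 * c.im)
    (hB : ∀ y ∈ uIcc a b, ‖xiSq ((c + (y : ℂ) * I) ^ 2) * sqKernel n c (c + (y : ℂ) * I)‖ +
      ‖xiSq ((c - (y : ℂ) * I) ^ 2) * sqKernel n c (c - (y : ℂ) * I)‖ ≤ B) :
    ‖xiSqArcU n a c - xiSqArcU n b c‖ ≤ (n.factorial : ℝ) / (2 * π) * (|a - b| * B) := by
  rcases le_total b a with hle | hle
  · rw [uIcc_of_ge hle] at hB
    rw [abs_of_nonneg (by linarith)]
    exact norm_xiSqArcU_sub_xiSqArcU_le n hb hle hac hB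
  · rw [uIcc_of_le hle] at hB
    rw [norm_sub_rev, abs_of_nonpos (by linarith), neg_sub]
    exact norm_xiSqArcU_sub_xiSqArcU_le n ha hle hbc hB

end Summit.RiemannHypothesis.RiemannHypothesis.Theorems.JensenPolynomials.LogBandArc

end
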